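import Mathlib
import HarnessLib
import Summits.MatrixMultiplication.MatrixMultiplication.Theorems.FarEdgeDescentQuantumTwin
import Literature.Computability.AlgebraicComplexity.RectangularExponentAsymptoticRank
import Literature.Computability.AlgebraicComplexity.RectangularExponentInformationBound
import Literature.Computability.AlgebraicComplexity.AsymptoticSpectrumDuality
import Literature.Computability.AlgebraicComplexity.DegenerationSpectralMonotone
import Literature.Computability.AlgebraicComplexity.AsymptoticRankBorderRank
import Literature.Computability.AlgebraicComplexity.QuantumFunctionalPointHolds
import Literature.Computability.AlgebraicComplexity.QuantumFunctionalsBounds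
import Literature.Computability.AlgebraicComplexity.BorderRankCWDischarge

/-!
# FarEdgeDescent — Kernel XLIX-A (lens-2 «structural dichotomy», gen 64): hosts of a far-edge
exponent, their profile, and the border-flat / strictly-flat dichotomy

Route-independent half (no `Theses` import) of the helper pair for the crux `FiniteSaturation`
(stmt-MatrixMultiplication-23739, `∃ k ≥ 2, ω(1,k,1) = k + 1`); the companion
`FarEdgeDescentHostBridge` turns §1 into `FiniteSaturation` and records the EQUIV boundary.
No definition is introduced: the HOST hypothesis is spelled out inline —

  `Host_k(t, r)`: `R̃(t) ≤ r` and, for every `ε > 0`, some Kronecker power `t^{⊠(N+1)}` degenerates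
  (`AlgDegeneratesTo`, BCS (15.19)) to some `⟨m, m^k, m⟩`, `m ≥ 2`, with `r^{N+1} ≤ m^{(k+1)(1+ε)}`.

This is the shape of every catalogued upper-bound method for a rectangular exponent (CLLZ 2025
§3: one fixed tensor, a rank proxy — in practice ONE border-rank identity — and degenerations of
powers).

* §1 `omegaRect_le_of_host`, `omegaRect_eq_of_host`: `Host_k(t, r) ⟹ ω(1,k,1) = k + 1`.
* §2 PROFILE (CLLZ Thm. 3.15 at `(p, ω̂) = (k, k+1)` for the quantum functionals, universal spectral
  points by the tree's `isUniversalSpectralPoint_quantumFunctionalPoint`):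
  `F^θ(t) ≥ r^{1 − (k−1)θ₀/(k+1)}` for all `θ ∈ Δ₂` (`rpow_le_quantumFunctional_of_host'`; ε-form
  `rpow_le_quantumFunctional_of_host`; the value `F^θ(⟨m,m^k,m⟩) = m^{2θ₀+(k+1)(θ₁+θ₂)}`,
  `quantumFunctional_matMulTensor_farEdge`). Face `θ₀ = 0`: the proxy is never slack, `R̃(t) = r`
  (`asymptoticRank_eq_of_host`), and a host is FLAT in its two large directions, `r ≤ min(|κ|,|μ|)`
  (`le_card_of_host`).
* §3 DICHOTOMY (special vs generic; exhaustive since `R̃ ≤ R̲`): a host certified by a border-rank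
  identity `R̲(t) ≤ b` is *border-flat of minimal border rank*, `R̲(t) = R̃(t) = b ≤ min(|κ|,|μ|)`
  (`borderHost_flat`) — the JLP / Bläser–Lysikov class of objects; a host with
  `R̲(t) > min(|κ|,|μ|)` is certified only through a proxy STRICTLY BELOW its border rank, i.e.
  through an Alman–Li-type
  asymptotic-rank theorem (`asymptoticRank_lt_algBorderRank_of_host`, `not_borderHost_of_card_lt`).
  The little Coppersmith–Winograd tensor is the generic instance: `R̲(cw_q) = q + 2 > q + 1 = |κ|`,
  so its only admissible proxy is `r = q + 1 = R̃(cw_q)` — the shape of the route's aside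
  `LittleCwFlat` (`cwTensor_host_proxy`, `cwTensor_not_borderHost`).

Barriers: `Literature.Barriers.MatrixMultiplication.RectangularBarrier` (CLLZ) — §2 IS its
inequality on the far edge, used as a design specification for hosts, not evaded;
`UnstableTensorBarrier`
(Bläser–Lysikov Thm. 16) bars `ω = 2` from minimal-border-rank binding tensors, not a finite
saturation, which tolerates the profile deficit `(k−1)θ₀/(k+1)` off the face.

[cite: ChristandlLeGallLysikovZuiddam2025, Thm. 2.1 and Thm. 3.15]
[cite: ChristandlVranaZuiddam2023, Cor. 3.31 and Thm. 3.19] [cite: AlmanLi2026, Cor. 6.1]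
[cite: BurgisserClausenShokrollahi1997, (15.19) and Lemma (15.27)]
-/

open scoped BigOperators Topology
open Filter

namespace Summit.MatrixMultiplication.MatrixMultiplication.Theorems.FarEdgeDescentHostProfile

open Literature.Computability.AlgebraicComplexity
open Summit.MatrixMultiplication.MatrixMultiplication.Theorems.FarEdgeDescentQuantumTwin
  (logQuantumFunctional_matMulTensor matMulTensor_ne_zero)

/-! ## §0 Helpers -/

/-- If `r^{c/(1+ε)} ≤ s` for every `ε > 0` and `r > 0`, then `r^c ≤ s` (continuity of
`ε ↦ r^{c/(1+ε)}` at `0`). [folklore] -/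
theorem rpow_le_of_forall_rpow_div_one_add_le {r s c : ℝ} (hr : 0 < r)
    (h : ∀ ε : ℝ, 0 < ε → r ^ (c / (1 + ε)) ≤ s) : r ^ c ≤ s := by
  have hcont : ContinuousAt (fun ε : ℝ => r ^ (c / (1 + ε))) 0 := by
    have h1 : ContinuousAt (fun ε : ℝ => c / (1 + ε)) 0 :=
      ContinuousAt.div continuousAt_const (continuousAt_const.add continuousAt_id) (by norm_num)
    exact ContinuousAt.rpow continuousAt_const h1 (Or.inl hr.ne')
  have htend : Tendsto (fun ε : ℝ => r ^ (c / (1 + ε))) (𝓝[>] (0 : ℝ)) (𝓝 (r ^ c)) := by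
    have := hcont.tendsto
    simp only [add_zero, div_one] at this
    exact tendsto_nhdsWithin_of_tendsto_nhds this
  exact le_of_tendsto htend (eventually_nhdsWithin_of_forall fun ε hε => h ε hε)

/-- If `r^{1/(1+ε)} ≤ s` for every `ε > 0` and `r > 0`, then `r ≤ s`. [folklore] -/
theorem le_of_forall_rpow_inv_one_add_le {r s : ℝ} (hr : 0 < r)
    (h : ∀ ε : ℝ, 0 < ε → r ^ (1 / (1 + ε)) ≤ s) : r ≤ s := by
  have := rpow_le_of_forall_rpow_div_one_add_le (c := 1) hr h
  rwa [Real.rpow_one] at this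

/-- `R̃(t^{⊠ n}) ≤ R̃(t)^n`. [cite: Strassen1988, Thm. 3.8] -/
theorem asymptoticRank_kroneckerPow_le {ι κ μ : Type} [Fintype ι] [Fintype κ] [Fintype μ]
    (t : ι → κ → μ → ℂ) (n : ℕ) :
    asymptoticRank (kroneckerPow t n) ≤ asymptoticRank t ^ n := by
  obtain ⟨Φ, hΦ, hΦeq⟩ := (strassen_duality_asymptoticRank_holds ℂ (kroneckerPow t n)).2
  rw [← hΦeq, hΦ.map_kroneckerPow]
  exact pow_le_pow_left₀ (hΦ.nonneg t) ((strassen_duality_asymptoticRank_holds ℂ t).1 Φ hΦ) n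

/-- `m^{ω(1,k,1)} = R̃(⟨m, m^k, m⟩)` for `m ≥ 2` (ADVXXZ §3.4 in the tree's rank form).
[cite: AlmanDuanVassilevskaWilliamsXuXuZhou2025, §3.4] -/
theorem rpow_omegaRect_eq_asymptoticRank_farEdge {m : ℕ} (hm : 2 ≤ m) (k : ℕ) :
    (m : ℝ) ^ omegaRect ℂ 1 k 1 = asymptoticRank (matMulTensor ℂ m (m ^ k) m) := by
  have h := asymptoticRank_matMulTensor_rect ℂ hm 1 k 1
  rw [pow_one] at h
  rw [h]
  simp

/-- The information lower bound on the far edge, `k + 1 ≤ ω(1,k,1)`.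
[cite: LottiRomani1983, §2 (p. 174)] -/
theorem add_one_le_omegaRect_farEdge (k : ℕ) : (k : ℝ) + 1 ≤ omegaRect ℂ 1 k 1 :=
  le_trans (le_max_right 2 ((k : ℝ) + 1)) (max_two_add_one_le_omegaRect_one_mid_one ℂ (k : ℝ))

/-- **`F^θ(⟨m, m^k, m⟩) = m^{2θ₀ + (k+1)(θ₁ + θ₂)}`** (`θ ≥ 0`, `m ≥ 1`; flattening ranks
`m², m^{k+1}, m^{k+1}`, maximally mixed marginals). [cite: ChristandlVranaZuiddam2023, Thm. 3.19] -/
theorem quantumFunctional_matMulTensor_farEdge {θ : Fin 3 → ℝ} (hθ : ∀ i, 0 ≤ θ i) {m : ℕ}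
    (hm : 1 ≤ m) (k : ℕ) :
    quantumFunctional θ (matMulTensor ℂ m (m ^ k) m) =
      (m : ℝ) ^ (2 * θ 0 + ((k : ℝ) + 1) * (θ 1 + θ 2)) := by
  have hmk : 1 ≤ m ^ k := Nat.one_le_pow k m hm
  have hm0 : (0 : ℝ) < m := by exact_mod_cast hm
  rw [quantumFunctional_of_ne_zero θ (matMulTensor_ne_zero m (m ^ k) m hm hmk hm),
    logQuantumFunctional_matMulTensor m (m ^ k) m hθ hm hmk hm]
  have h1 : Real.log ((m : ℝ) * m) = 2 * Real.log m := by
    rw [← sq, Real.log_pow]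
    push_cast
    ring
  have h2 : Real.log ((m : ℝ) * ((m ^ k : ℕ) : ℝ)) = ((k : ℝ) + 1) * Real.log m := by
    push_cast
    rw [← pow_succ', Real.log_pow]
    push_cast
    ring
  have h3 : Real.log (((m ^ k : ℕ) : ℝ) * m) = ((k : ℝ) + 1) * Real.log m := by
    push_cast
    rw [← pow_succ, Real.log_pow]
    push_cast
    ring
  rw [h1, h2, h3, ← two_rpow_mul_log_div_log hm0]
  congr 1
  ring

section Host

variable {ι κ μ : Type} [Fintype ι] [Fintype κ] [Fintype μ] [DecidableEq ι] [DecidableEq κ]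
  [DecidableEq μ] {t : ι → κ → μ → ℂ} {r : ℝ} {k : ℕ} (hr : asymptoticRank t ≤ r)
  (hhost : ∀ ε : ℝ, 0 < ε → ∃ N m : ℕ, 2 ≤ m ∧
    AlgDegeneratesTo (kroneckerPow t (N + 1)) (matMulTensor ℂ m (m ^ k) m) ∧
    r ^ (N + 1) ≤ (m : ℝ) ^ (((k : ℝ) + 1) * (1 + ε)))
include hr hhost

/-! ## §1 The host bound -/

omit [DecidableEq ι] [DecidableEq κ] [DecidableEq μ] in
/-- **A host certifies the far-edge exponent**: `Host_k(t, r) ⟹ ω(1,k,1) ≤ k + 1`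
(`m^{ω(1,k,1)} = R̃(⟨m,m^k,m⟩) ≤ R̃(t^{⊠(N+1)}) ≤ R̃(t)^{N+1} ≤ r^{N+1} ≤ m^{(k+1)(1+ε)}`).
[cite: ChristandlLeGallLysikovZuiddam2025, Thm. 2.1] -/
theorem omegaRect_le_of_host : omegaRect ℂ 1 k 1 ≤ (k : ℝ) + 1 := by
  refine le_of_forall_pos_lt_add fun δ hδ => ?_
  have hk1 : (0 : ℝ) < (k : ℝ) + 1 := by positivity
  obtain ⟨N, m, hm, hdeg, hcost⟩ := hhost (δ / (2 * ((k : ℝ) + 1))) (by positivity)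
  have hm1 : (1 : ℝ) < (m : ℝ) := by exact_mod_cast hm
  -- `R̃` is degeneration-monotone (the point of `Δ` attaining `R̃(⟨m,m^k,m⟩)` is); cf. the
  -- tree's `SoloInformedGammaDoor.asymptoticRank_le_of_algDegeneratesTo` (route-independence).
  have hmono : asymptoticRank (matMulTensor ℂ m (m ^ k) m) ≤
      asymptoticRank (kroneckerPow t (N + 1)) := by
    obtain ⟨Φ, hΦ, hΦt⟩ :=
      (strassen_duality_asymptoticRank_holds ℂ (matMulTensor ℂ m (m ^ k) m)).2
    rw [← hΦt]
    exact (hΦ.mono_of_algDegeneratesTo hdeg).trans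
      ((strassen_duality_asymptoticRank_holds ℂ _).1 Φ hΦ)
  have hchain : (m : ℝ) ^ omegaRect ℂ 1 k 1 ≤
      (m : ℝ) ^ (((k : ℝ) + 1) * (1 + δ / (2 * ((k : ℝ) + 1)))) :=
    calc (m : ℝ) ^ omegaRect ℂ 1 k 1 = asymptoticRank (matMulTensor ℂ m (m ^ k) m) :=
          rpow_omegaRect_eq_asymptoticRank_farEdge hm k
      _ ≤ asymptoticRank (kroneckerPow t (N + 1)) := hmono
      _ ≤ asymptoticRank t ^ (N + 1) := asymptoticRank_kroneckerPow_le t (N + 1)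
      _ ≤ r ^ (N + 1) := pow_le_pow_left₀ (asymptoticRank_nonneg t) hr (N + 1)
      _ ≤ _ := hcost
  have hω : omegaRect ℂ 1 k 1 ≤ ((k : ℝ) + 1) * (1 + δ / (2 * ((k : ℝ) + 1))) :=
    (Real.rpow_le_rpow_left_iff hm1).1 hchain
  have hid : ((k : ℝ) + 1) * (1 + δ / (2 * ((k : ℝ) + 1))) = (k : ℝ) + 1 + δ / 2 := by
    field_simp
  linarith

omit [DecidableEq ι] [DecidableEq κ] [DecidableEq μ] in
/-- **`Host_k(t, r) ⟹ ω(1,k,1) = k + 1`** (with the information bound).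
[cite: ChristandlLeGallLysikovZuiddam2025, Thm. 2.1] -/
theorem omegaRect_eq_of_host : omegaRect ℂ 1 k 1 = (k : ℝ) + 1 :=
  le_antisymm (omegaRect_le_of_host hr hhost) (add_one_le_omegaRect_farEdge k)

omit [DecidableEq ι] [DecidableEq κ] [DecidableEq μ] in
/-- **A host's proxy exceeds `1`** (`m^{k+1} ≤ m^{ω(1,k,1)} ≤ r^{N+1}`, `m ≥ 2`). [folklore] -/
theorem one_lt_of_host : 1 < r := by
  obtain ⟨N, m, hm, hdeg, hcost⟩ := hhost 1 one_pos
  have hr0 : 0 ≤ r := le_trans (asymptoticRank_nonneg t) hr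
  have hm1 : (1 : ℝ) < (m : ℝ) := by exact_mod_cast hm
  have hmono : asymptoticRank (matMulTensor ℂ m (m ^ k) m) ≤
      asymptoticRank (kroneckerPow t (N + 1)) := by
    obtain ⟨Φ, hΦ, hΦt⟩ :=
      (strassen_duality_asymptoticRank_holds ℂ (matMulTensor ℂ m (m ^ k) m)).2
    rw [← hΦt]
    exact (hΦ.mono_of_algDegeneratesTo hdeg).trans
      ((strassen_duality_asymptoticRank_holds ℂ _).1 Φ hΦ)
  have hchain : (m : ℝ) ^ ((k : ℝ) + 1) ≤ r ^ (N + 1) :=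
    calc (m : ℝ) ^ ((k : ℝ) + 1) ≤ (m : ℝ) ^ omegaRect ℂ 1 k 1 :=
          Real.rpow_le_rpow_of_exponent_le hm1.le (add_one_le_omegaRect_farEdge k)
      _ = asymptoticRank (matMulTensor ℂ m (m ^ k) m) :=
          rpow_omegaRect_eq_asymptoticRank_farEdge hm k
      _ ≤ asymptoticRank (kroneckerPow t (N + 1)) := hmono
      _ ≤ asymptoticRank t ^ (N + 1) := asymptoticRank_kroneckerPow_le t (N + 1)
      _ ≤ r ^ (N + 1) := pow_le_pow_left₀ (asymptoticRank_nonneg t) hr (N + 1)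
  have hgt : (1 : ℝ) < (m : ℝ) ^ ((k : ℝ) + 1) := Real.one_lt_rpow hm1 (by positivity)
  refine lt_of_not_ge fun hle => ?_
  have : r ^ (N + 1) ≤ 1 := pow_le_one₀ hr0 hle
  linarith

/-! ## §2 The profile of a host -/

/-- **The profile of a host, ε-form** (CLLZ Thm. 3.15 at `(p, ω̂) = (k, k+1)` for `F^θ ∈ Δ`):
`F^θ(t) ≥ r^{(2θ₀ + (k+1)(θ₁+θ₂)) / ((k+1)(1+ε))}` for every `θ ∈ Δ₂` and `ε > 0`
(`F^θ(t)^{N+1} = F^θ(t^{⊠(N+1)}) ≥ F^θ(⟨m,m^k,m⟩) = m^{2θ₀+(k+1)(θ₁+θ₂)}` and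
`r ≤ m^{(k+1)(1+ε)/(N+1)}`).
[cite: ChristandlLeGallLysikovZuiddam2025, Thm. 3.15] -/
theorem rpow_le_quantumFunctional_of_host {θ : Fin 3 → ℝ} (hθ : θ ∈ stdSimplex ℝ (Fin 3))
    (ε : ℝ) (hε : 0 < ε) :
    r ^ ((2 * θ 0 + ((k : ℝ) + 1) * (θ 1 + θ 2)) / (((k : ℝ) + 1) * (1 + ε))) ≤
      quantumFunctional θ t := by
  obtain ⟨N, m, hm, hdeg, hcost⟩ := hhost ε hε
  have hθ0 : ∀ i, 0 ≤ θ i := fun i => hθ.1 i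
  set c : ℝ := 2 * θ 0 + ((k : ℝ) + 1) * (θ 1 + θ 2) with hc
  have hc0 : 0 ≤ c := by
    have := hθ0 0; have := hθ0 1; have := hθ0 2
    positivity
  have hm1 : 1 ≤ m := le_trans one_le_two hm
  have hm0 : (0 : ℝ) ≤ m := by positivity
  have hr0 : 0 ≤ r := le_trans (asymptoticRank_nonneg t) hr
  have hk1 : (0 : ℝ) < ((k : ℝ) + 1) * (1 + ε) := by positivity
  have hninv : (0 : ℝ) ≤ ((N + 1 : ℕ) : ℝ)⁻¹ := by positivity
  have hΦ := isUniversalSpectralPoint_quantumFunctionalPoint hθ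
  have hF : (m : ℝ) ^ c ≤ quantumFunctional θ t ^ (N + 1) := by
    have h1 := hΦ.mono_of_algDegeneratesTo hdeg
    rw [hΦ.map_kroneckerPow] at h1
    simp only [quantumFunctionalPoint_apply] at h1
    rwa [quantumFunctional_matMulTensor_farEdge hθ0 hm1 k] at h1
  have hFnn : 0 ≤ quantumFunctional θ t := quantumFunctional_nonneg θ t
  have hroot : (m : ℝ) ^ (c * ((N + 1 : ℕ) : ℝ)⁻¹) ≤ quantumFunctional θ t := by
    have := Real.rpow_le_rpow (by positivity) hF hninv
    rwa [Real.pow_rpow_inv_natCast hFnn (Nat.succ_ne_zero N), ← Real.rpow_mul hm0] at this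
  have hr' : r ≤ (m : ℝ) ^ (((k : ℝ) + 1) * (1 + ε) * ((N + 1 : ℕ) : ℝ)⁻¹) := by
    have := Real.rpow_le_rpow (by positivity) hcost hninv
    rwa [Real.pow_rpow_inv_natCast hr0 (Nat.succ_ne_zero N), ← Real.rpow_mul hm0] at this
  calc r ^ (c / (((k : ℝ) + 1) * (1 + ε)))
      ≤ ((m : ℝ) ^ (((k : ℝ) + 1) * (1 + ε) * ((N + 1 : ℕ) : ℝ)⁻¹)) ^
          (c / (((k : ℝ) + 1) * (1 + ε))) :=
        Real.rpow_le_rpow hr0 hr' (by positivity)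
    _ = (m : ℝ) ^ (c * ((N + 1 : ℕ) : ℝ)⁻¹) := by
        rw [← Real.rpow_mul hm0]
        congr 1
        field_simp
    _ ≤ quantumFunctional θ t := hroot

/-- **The profile, limit form: `F^θ(t) ≥ r^{1 − (k−1)θ₀/(k+1)}`** for every `θ ∈ Δ₂` — the
far-edge case of CLLZ's barrier inequality
`ω̂ · log F(t) ≥ log(F⟨2,1,1⟩ (F⟨1,2,1⟩ F⟨1,1,2⟩)^p) · log R̃(t)` for `F = F^θ`, read as a design
specification for hosts. [cite: ChristandlLeGallLysikovZuiddam2025, Thm. 3.15] -/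
theorem rpow_le_quantumFunctional_of_host' {θ : Fin 3 → ℝ} (hθ : θ ∈ stdSimplex ℝ (Fin 3)) :
    r ^ (1 - ((k : ℝ) - 1) * θ 0 / ((k : ℝ) + 1)) ≤ quantumFunctional θ t := by
  have hr1 := one_lt_of_host hr hhost
  have hk0 : (k : ℝ) + 1 ≠ 0 := by positivity
  have hsum : θ 0 + θ 1 + θ 2 = 1 := by
    have := hθ.2
    rwa [Fin.sum_univ_three] at this
  have h12 : θ 1 + θ 2 = 1 - θ 0 := by linarith
  have hc : (2 * θ 0 + ((k : ℝ) + 1) * (θ 1 + θ 2)) / ((k : ℝ) + 1) =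
      1 - ((k : ℝ) - 1) * θ 0 / ((k : ℝ) + 1) := by
    rw [h12, eq_sub_iff_add_eq, ← add_div, div_eq_one_iff_eq hk0]
    ring
  rw [← hc]
  refine rpow_le_of_forall_rpow_div_one_add_le (by linarith) fun ε hε => ?_
  have h := rpow_le_quantumFunctional_of_host hr hhost hθ ε hε
  rwa [← div_div] at h

/-- **The proxy of a host is never slack: `R̃(t) = r`** (face `θ = (0,1,0)`:
`r^{1/(1+ε)} ≤ F^{(0,1,0)}(t) ≤ R̃(t) ≤ r`).
[cite: ChristandlLeGallLysikovZuiddam2025, Thm. 3.15] -/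
theorem asymptoticRank_eq_of_host : asymptoticRank t = r := by
  refine le_antisymm hr ?_
  have hθ : (![0, 1, 0] : Fin 3 → ℝ) ∈ stdSimplex ℝ (Fin 3) :=
    ⟨fun i => by fin_cases i <;> simp, by simp [Fin.sum_univ_three]⟩
  have hr1 := one_lt_of_host hr hhost
  have h := rpow_le_quantumFunctional_of_host' hr hhost hθ
  have hexp : 1 - ((k : ℝ) - 1) * (![0, 1, 0] : Fin 3 → ℝ) 0 / ((k : ℝ) + 1) = 1 := by simp
  rw [hexp, Real.rpow_one] at h
  refine h.trans ?_
  simpa using (strassen_duality_asymptoticRank_holds ℂ t).1 _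
    (isUniversalSpectralPoint_quantumFunctionalPoint hθ)

/-- **A host is flat in its two large directions: `r ≤ |κ|` and `r ≤ |μ|`** (faces `(0,1,0)`,
`(0,0,1)` against the flattening bounds `F^{(0,1,0)}(t) ≤ |κ|`, `F^{(0,0,1)}(t) ≤ |μ|`).
[cite: ChristandlVranaZuiddam2023, Thm. 3.19] -/
theorem le_card_of_host : r ≤ Fintype.card κ ∧ r ≤ Fintype.card μ := by
  have hB := ChristandlVranaZuiddam2023_bounds_holds
  have hθ₁ : (![0, 1, 0] : Fin 3 → ℝ) ∈ stdSimplex ℝ (Fin 3) :=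
    ⟨fun i => by fin_cases i <;> simp, by simp [Fin.sum_univ_three]⟩
  have hθ₂ : (![0, 0, 1] : Fin 3 → ℝ) ∈ stdSimplex ℝ (Fin 3) :=
    ⟨fun i => by fin_cases i <;> simp, by simp [Fin.sum_univ_three]⟩
  have h₁ := rpow_le_quantumFunctional_of_host' hr hhost hθ₁
  have h₂ := rpow_le_quantumFunctional_of_host' hr hhost hθ₂
  have e₁ : 1 - ((k : ℝ) - 1) * (![0, 1, 0] : Fin 3 → ℝ) 0 / ((k : ℝ) + 1) = 1 := by simp
  have e₂ : 1 - ((k : ℝ) - 1) * (![0, 0, 1] : Fin 3 → ℝ) 0 / ((k : ℝ) + 1) = 1 := by simp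
  rw [e₁, Real.rpow_one] at h₁
  rw [e₂, Real.rpow_one] at h₂
  have b₁ := (hB _ hθ₁ t).2
  have b₂ := (hB _ hθ₂ t).2
  simp only [Matrix.cons_val_zero, Matrix.cons_val_one, Matrix.head_cons, Matrix.cons_val_two,
    Matrix.tail_cons, Real.rpow_zero, Real.rpow_one, one_mul, mul_one] at b₁ b₂
  exact ⟨h₁.trans (b₁.trans (min_le_left _ _)), h₂.trans (b₂.trans (min_le_left _ _))⟩

/-! ## §3 The dichotomy: border-flat hosts (special) vs strictly-flat hosts (generic) -/

/-- **Generic branch — a host that is not of minimal border rank is certified strictly below its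
border rank**: if `|κ| < R̲(t)` or `|μ| < R̲(t)`, every host certificate on `t` has
`R̃(t) = r < R̲(t)` (an Alman–Li-type theorem, never a single border identity for `t`).
[cite: AlmanLi2026, Cor. 6.1] -/
theorem asymptoticRank_lt_algBorderRank_of_host
    (hκμ : Fintype.card κ < algBorderRank t ∨ Fintype.card μ < algBorderRank t) :
    asymptoticRank t = r ∧ r < algBorderRank t := by
  have hc := le_card_of_host hr hhost
  refine ⟨asymptoticRank_eq_of_host hr hhost, ?_⟩
  rcases hκμ with h | h
  · exact lt_of_le_of_lt hc.1 (by exact_mod_cast h)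
  · exact lt_of_le_of_lt hc.2 (by exact_mod_cast h)

end Host

section Border

variable {ι κ μ : Type} [Fintype ι] [Fintype κ] [Fintype μ] [DecidableEq ι] [DecidableEq κ]
  [DecidableEq μ] {t : ι → κ → μ → ℂ} {k : ℕ}

/-- **Special branch — a border-certified host is border-flat of minimal border rank**: if the proxy
is a border identity `R̲(t) ≤ b`, then `R̃(t) = R̲(t) = b ≤ min(|κ|, |μ|)` (`R̃ ≤ R̲`, BCS (15.27),
and §2). So this branch of a finite saturation asks for ONE tensor of minimal border rank whose
powers reach the far edge at full value. [cite: BurgisserClausenShokrollahi1997, Lemma (15.27)] -/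
theorem borderHost_flat {b : ℕ} (hb : algBorderRank t ≤ b)
    (hhost : ∀ ε : ℝ, 0 < ε → ∃ N m : ℕ, 2 ≤ m ∧
      AlgDegeneratesTo (kroneckerPow t (N + 1)) (matMulTensor ℂ m (m ^ k) m) ∧
      (b : ℝ) ^ (N + 1) ≤ (m : ℝ) ^ (((k : ℝ) + 1) * (1 + ε))) :
    asymptoticRank t = b ∧ algBorderRank t = b ∧ b ≤ Fintype.card κ ∧ b ≤ Fintype.card μ := by
  have hR : asymptoticRank t = b :=
    asymptoticRank_eq_of_host (asymptoticRank_le_of_algBorderRank_le hb) hhost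
  have h1 : (b : ℝ) ≤ algBorderRank t := hR ▸ asymptoticRank_le_algBorderRank t
  have hbe : algBorderRank t = b := le_antisymm hb (by exact_mod_cast h1)
  have hc := le_card_of_host (asymptoticRank_le_of_algBorderRank_le hb) hhost
  exact ⟨hR, hbe, by exact_mod_cast hc.1, by exact_mod_cast hc.2⟩

/-- **No border certificate above the flattening dimension**: if `|κ| < R̲(t)` then `t` is not a
border-certified host of any far edge. [cite: ChristandlLeGallLysikovZuiddam2025, Thm. 3.15] -/
theorem not_borderHost_of_card_lt (hκ : Fintype.card κ < algBorderRank t) :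
    ¬ (∀ ε : ℝ, 0 < ε → ∃ N m : ℕ, 2 ≤ m ∧
      AlgDegeneratesTo (kroneckerPow t (N + 1)) (matMulTensor ℂ m (m ^ k) m) ∧
      (algBorderRank t : ℝ) ^ (N + 1) ≤ (m : ℝ) ^ (((k : ℝ) + 1) * (1 + ε))) :=
  fun hhost => absurd (borderHost_flat (k := k) le_rfl hhost).2.2.1 (not_le.2 hκ)

end Border

/-! ### The generic instance: the little Coppersmith–Winograd tensor -/

/-- **`cw_q` admits only the proxy `r ≤ q + 1`**: a host certificate on `cw_q` for a far edge has
`R̃(cw_q) = r ≤ q + 1 = |κ|`, i.e. presupposes `R̃(cw_q) ≤ q + 1 < q + 2 = R̲(cw_q)` — the shape of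
the route's aside `LittleCwFlat`. [cite: CoppersmithWinograd1990, §6] -/
theorem cwTensor_host_proxy {q k : ℕ} {r : ℝ} (hr : asymptoticRank (cwTensor ℂ q) ≤ r)
    (hhost : ∀ ε : ℝ, 0 < ε → ∃ N m : ℕ, 2 ≤ m ∧
      AlgDegeneratesTo (kroneckerPow (cwTensor ℂ q) (N + 1)) (matMulTensor ℂ m (m ^ k) m) ∧
      r ^ (N + 1) ≤ (m : ℝ) ^ (((k : ℝ) + 1) * (1 + ε))) :
    asymptoticRank (cwTensor ℂ q) = r ∧ r ≤ (q : ℝ) + 1 := by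
  have h := (le_card_of_host hr hhost).1
  simp only [Fintype.card_fin, Nat.cast_add, Nat.cast_one] at h
  exact ⟨asymptoticRank_eq_of_host hr hhost, h⟩

/-- **The border identity `R̲(cw_q) = q + 2` never certifies a far edge** (`q ≥ 2`;
`|κ| = q + 1 < q + 2 ≤ R̲(cw_q)`, tree `le_algBorderRank_cwTensor`).
[cite: ConnerGesmundoLandsbergVentura2022, §1.2] -/
theorem cwTensor_not_borderHost {q k : ℕ} (hq : 2 ≤ q) :
    ¬ (∀ ε : ℝ, 0 < ε → ∃ N m : ℕ, 2 ≤ m ∧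
      AlgDegeneratesTo (kroneckerPow (cwTensor ℂ q) (N + 1)) (matMulTensor ℂ m (m ^ k) m) ∧
      (algBorderRank (cwTensor ℂ q) : ℝ) ^ (N + 1) ≤ (m : ℝ) ^ (((k : ℝ) + 1) * (1 + ε))) :=
  not_borderHost_of_card_lt (k := k) (by
    rw [Fintype.card_fin]
    have := le_algBorderRank_cwTensor ℂ hq
    omega)

end Summit.MatrixMultiplication.MatrixMultiplication.Theorems.FarEdgeDescentHostProfile
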